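import Mathlib
import Literature.Analysis.Complex.OsgoodProofs

/-!
# NE9 · route R4 «FADING BY EARLE–HAMILTON» · price item P2♭ — the ℓ^∞-ASSEMBLY HALF of EH2(ii)
# («coordinatewise uniform Cauchy estimates»): a UNIFORMLY BOUNDED family of scalar holomorphic functions on an open set of a
# complex normed space is ONE holomorphic map into `ℓ^∞`
# (cell `pub-balaban`, T4-DAG §2 node U3 ∕ §6 NE9; AUTHOR unit `b2b-balaban-t4-ne9-formalise-leaf-05` gen 44 — bytes
# `HOME/t4/b2b-balaban-t4-ne9-formalise-leaf-05/g44/p2/NE9EllInftyHolomorphy.rc0.lean` sha16 ff79b998b846cc34, certificate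
# `PREBUILD-R4-P2flat-EllInftyHolomorphy.md`; FILED by `b2b-balaban-t4-ne9-formalise-leaf-03` gen 39 on the row owner's INTERFACE REQUEST NE9
# (R4-2), journal l.28192, under the author's custody offer l.28132 — namespace moved to the tree convention, nothing else changed)

HONEST DEPENDENCY: continuum YM on T⁴ ⇐ BetaPertH ∧ nine spine estimates (0/9 proved); BetaPertH ⇐ (D1) ∧ (D4) ∧ CAP+tail;
G-an2-4 gates asym, D1 and NE2/3/4.
HONEST FRAMING: fixed finite T⁴, rung (B)+1 — NOT infinite volume, NOT a mass gap, NOT the Clay problem.  NE9 is NOT PRINTED and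
NOT PROVED; route R4 is KEEP-conditional (PRICING-NE9 v4) and its interface was WORDED by the row owner t4-ne9-p1 g60 (journal l.28192,
(R4-1)–(R4-4)).  This file is generic complex analysis; it constructs no object of Bałaban's and discharges no Bałaban-side hypothesis;
the scalar half (♮) is `Literature/Analysis/Complex/GateauxHolomorphicBall` (Graves–Taylor–Hille–Zorn on a ball, p252095).

WHERE IT SITS.  `pub-balaban/t4/ROUTES-NE9.md` v3.0.1 §L1.0, step EH2(ii): the history step in future-influence coordinates is
Fréchet-holomorphic iff the table map `Ψ_k^ℂ(g_k, ·) : Pot ⊇ B(0,r) → 𝔜` is, where `𝔜` is an ℓ^∞-TYPE space (decay-weighted sup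
norm over the slice coordinates `(U, X)`); the pencil route supplies holomorphy COORDINATE BY COORDINATE plus a UNIFORM majorant, and
«G-holomorphic + locally bounded ⇒ holomorphic into the ℓ^∞-type space 𝔜 (coordinatewise uniform Cauchy estimates; [Chae1985]
Ch. 14, Hille–Phillips Thm 3.17.1, Mujica §8 — E19; est. 200–300 l.; the tree holds only the finite-dimensional Osgood bridge)»
is priced as P2, «A REAL EXTRA OBLIGATION».  P2 has two halves: (♮) scalar Gâteaux → Fréchet holomorphy of each coordinate
(finite-dimensional `Pot`: the tree's `Literature.Analysis.Complex.SCV.differentiableOn_of_continuousOn_of_separately`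
(`OsgoodSeparate`) after a boundedness ⇒ continuity step; infinite-dimensional: Graves–Taylor–Hille–Zorn, untyped here) and (♭) the ASSEMBLY of a uniformly bounded family of Fréchet-holomorphic SCALAR coordinates into ONE
Fréchet-holomorphic `ℓ^∞`-valued map.  THIS FILE = (♭), in full generality (any index type, any complex normed domain space).
Mathlib has the finite-product rule `hasFDerivAt_pi` only; for an infinite index set the uniform bound is ESSENTIAL (test T2).

CONTENTS (all kernel-checked, 0 sorry).
* §1 one holomorphic function on a ball, bounded by `M`: the UNIFORM first-order bound `‖fderiv ℂ h c‖ ≤ 2M/R`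
  (`norm_fderiv_le_of_bound`, Mathlib's Schwarz lemma `Complex.norm_fderiv_le_div_of_mapsTo_ball`) and the UNIFORM second-order
  Taylor remainder `‖h w − h c − fderiv ℂ h c (w − c)‖ ≤ 4M·(‖w − c‖/R)²` (`norm_taylor₂_le_of_bound`, Mathlib's
  `Complex.dist_le_mul_div_pow_of_mapsTo_ball_of_isLittleO` at `n = 1`) — «Cauchy estimates», constants depending on `M, R` ONLY.
* §2 the packing `pack f : 𝔛 → ℓ^∞(I, ℂ)` of a family `f : I → 𝔛 → ℂ` (the genuine tuple where it is bounded, `0` elsewhere),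
  its SIZE `‖pack f x‖ ≤ M` / `MapsTo (pack f) U (closedBall 0 M)` from the same uniform bound (`norm_pack_le_of_bound`,
  `mapsTo_pack_closedBall` — the «self-map» clause of a `HoloSelfMaps`-type datum), the candidate derivative `packDeriv` (a bounded
  linear map, norm `≤ 2M/R`), and the main theorems
  `hasFDerivAt_pack` / `differentiableOn_pack` (+ `…_of_locallyBounded`) / `pack_fderiv_apply` / `norm_fderiv_pack_le` /
  `norm_pack_taylor₂_le`:
  each `f i` holomorphic on an open `U` + `sup_i ‖f i x‖ ≤ M` on `U` ⇒ `pack f` holomorphic (Fréchet) on `U` with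
  `(D(pack f)(x) v)_i = D(f i)(x) v`.
* §3 the WEIGHTED form (coordinates rescaled by fixed scalars `wgt i`, e.g. `e^{κ d(X)}`): `differentiableOn_pack_weighted`.
* §4 the `I →ᵇ ℂ`-valued form (discrete `I`; Mathlib's isometry `lpBCFₗᵢ`): `packBCF`, `differentiableOn_packBCF`.
* §5 finite-dimensional domain: `analyticOnNhd_pack` (the tree's Osgood lemma `SCV.analyticOnNhd_of_differentiableOn`; the one
  non-Mathlib import).
* §T tests: T1 non-vacuity (the family `z ↦ z^n`, `n : ℕ`, on the unit ball of `ℂ`, bound 1); T2 necessity of the UNIFORM bound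
  (the family `z ↦ n·z`: every coordinate entire, the tuple at `z ≠ 0` is not even in `ℓ^∞`).

References (TYPES / loci only; nothing printed is asserted): [Chae1985] S. B. Chae, Holomorphy and Calculus in Normed Spaces
(Dekker 1985), Ch. 14; [HillePhillips1957] E. Hille, R. S. Phillips, Functional Analysis and Semi-Groups, Thm 3.17.1;
[Mujica1986] J. Mujica, Complex Analysis in Banach Spaces, §8.  Cell: `pub-balaban`, row NE9, route R4 (t4-ne9-idea-1 v3),
unit `b2b-balaban-t4-ne9-formalise-leaf-05` gen 44 (author); filed by `b2b-balaban-t4-ne9-formalise-leaf-03` gen 39.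
-/

noncomputable section

open Metric Set Filter Asymptotics
open scoped Topology ENNReal

namespace Summit.QuantumFields.BalabanUV.T4Continuum.NE9EllInftyHolomorphy

variable {𝔛 : Type*} [NormedAddCommGroup 𝔛] [NormedSpace ℂ 𝔛]
variable {F : Type*} [NormedAddCommGroup F] [NormedSpace ℂ F]

/-! ## §1 Uniform Cauchy estimates for ONE bounded holomorphic function on a ball -/

omit [NormedSpace ℂ 𝔛] [NormedSpace ℂ F] in
/-- A function bounded by `M` on a ball maps the ball into the closed ball of radius `2M` around its value at the centre.
[folklore] -/
theorem mapsTo_closedBall_of_bound {h : 𝔛 → F} {c : 𝔛} {R M : ℝ} (hR : 0 < R)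
    (hb : ∀ w ∈ ball c R, ‖h w‖ ≤ M) : MapsTo h (ball c R) (closedBall (h c) (2 * M)) := by
  intro w hw
  have h1 := hb w hw
  have h2 := hb c (mem_ball_self hR)
  rw [mem_closedBall, dist_eq_norm]
  calc ‖h w - h c‖ ≤ ‖h w‖ + ‖h c‖ := norm_sub_le _ _
    _ ≤ M + M := add_le_add h1 h2
    _ = 2 * M := by ring

/-- **Uniform first-order Cauchy estimate.**  A function holomorphic on `ball c R` and bounded there by `M` has
`‖fderiv ℂ h c‖ ≤ 2M/R` (Schwarz lemma applied to the `2M`-ball around `h c`). [folklore] -/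
theorem norm_fderiv_le_of_bound {h : 𝔛 → F} {c : 𝔛} {R M : ℝ} (hR : 0 < R)
    (hd : DifferentiableOn ℂ h (ball c R)) (hb : ∀ w ∈ ball c R, ‖h w‖ ≤ M) :
    ‖fderiv ℂ h c‖ ≤ 2 * M / R :=
  Complex.norm_fderiv_le_div_of_mapsTo_ball hd (mapsTo_closedBall_of_bound hR hb) hR

/-- **Uniform second-order Cauchy estimate (Taylor remainder).**  A function holomorphic on `ball c R` and bounded there by
`M` satisfies `‖h w − h c − fderiv ℂ h c (w − c)‖ ≤ 4M·(‖w − c‖/R)²` on the ball: the remainder is holomorphic, vanishes to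
second order at `c`, and is bounded by `2M + (2M/R)·R = 4M` on the ball, so the Schwarz-type lemma with `n = 1` applies.
[folklore] -/
theorem norm_taylor₂_le_of_bound {h : 𝔛 → F} {c : 𝔛} {R M : ℝ} (hR : 0 < R)
    (hd : DifferentiableOn ℂ h (ball c R)) (hb : ∀ w ∈ ball c R, ‖h w‖ ≤ M) {w : 𝔛} (hw : w ∈ ball c R) :
    ‖h w - h c - fderiv ℂ h c (w - c)‖ ≤ 4 * M * (‖w - c‖ / R) ^ 2 := by
  -- the remainder `g`
  set g : 𝔛 → F := fun w => h w - h c - fderiv ℂ h c (w - c) with hg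
  have hgc : g c = 0 := by simp [hg]
  have hM : 0 ≤ M := (norm_nonneg _).trans (hb c (mem_ball_self hR))
  -- `g` is holomorphic on the ball
  have hdg : DifferentiableOn ℂ g (ball c R) :=
    (hd.sub_const (h c)).sub (((fderiv ℂ h c).differentiable.comp (differentiable_id.sub_const c)).differentiableOn)
  -- `g` maps the ball into the closed `4M`-ball around `g c = 0`
  have hD : ‖fderiv ℂ h c‖ ≤ 2 * M / R := norm_fderiv_le_of_bound hR hd hb
  have hmaps : MapsTo g (ball c R) (closedBall (g c) (4 * M)) := by
    intro u hu
    rw [mem_closedBall, hgc, dist_zero_right, hg]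
    have hu' : ‖u - c‖ < R := by rwa [mem_ball, dist_eq_norm] at hu
    have h1 : ‖h u - h c‖ ≤ 2 * M := by
      have := mapsTo_closedBall_of_bound hR hb hu
      rwa [mem_closedBall, dist_eq_norm] at this
    have h2 : ‖fderiv ℂ h c (u - c)‖ ≤ 2 * M := by
      calc ‖fderiv ℂ h c (u - c)‖ ≤ ‖fderiv ℂ h c‖ * ‖u - c‖ := ContinuousLinearMap.le_opNorm _ _
        _ ≤ (2 * M / R) * R := by gcongr
        _ = 2 * M := by field_simp
    calc ‖h u - h c - fderiv ℂ h c (u - c)‖ ≤ ‖h u - h c‖ + ‖fderiv ℂ h c (u - c)‖ := norm_sub_le _ _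
      _ ≤ 2 * M + 2 * M := add_le_add h1 h2
      _ = 4 * M := by ring
  -- `g` vanishes to second order at `c`
  have hhc : HasFDerivAt h (fderiv ℂ h c) c :=
    (hd.differentiableAt (isOpen_ball.mem_nhds (mem_ball_self hR))).hasFDerivAt
  have hn : (fun u => g u - g c) =o[𝓝 c] fun u => ‖u - c‖ ^ 1 := by
    refine (hhc.isLittleO.norm_right.congr_left fun u => ?_).congr_right fun u => (pow_one _).symm
    simp [hg]
  have key := Complex.dist_le_mul_div_pow_of_mapsTo_ball_of_isLittleO hdg hmaps hn hw
  rw [hgc, dist_zero_right, dist_eq_norm] at key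
  simpa [hg] using key

/-! ## §2 The ℓ^∞ packing of a uniformly bounded holomorphic family -/

variable {I : Type*}

/-- A pointwise bound puts the value family into `ℓ^∞`. [folklore] -/
theorem memℓp_infty_of_bound {g : I → ℂ} {M : ℝ} (h : ∀ i, ‖g i‖ ≤ M) : Memℓp g ∞ :=
  memℓp_infty ⟨M, by rintro _ ⟨i, rfl⟩; exact h i⟩

open Classical in
/-- The `ℓ^∞`-PACKING of a family of scalar functions: `x ↦ (f i x)_i` where that tuple is bounded, `0` elsewhere (a junk value
off the set of interest; on the sets where the theorems below are applied the tuple IS bounded). [folklore] -/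
def pack (f : I → 𝔛 → ℂ) (x : 𝔛) : lp (fun _ : I => ℂ) ∞ :=
  if hx : Memℓp (fun i => f i x) ∞ then ⟨fun i => f i x, hx⟩ else 0

omit [NormedAddCommGroup 𝔛] [NormedSpace ℂ 𝔛] in
/-- On the bounded locus the packing IS the tuple. [folklore] -/
theorem pack_apply {f : I → 𝔛 → ℂ} {x : 𝔛} (hx : Memℓp (fun i => f i x) ∞) (i : I) : pack f x i = f i x := by
  rw [pack, dif_pos hx]

omit [NormedAddCommGroup 𝔛] [NormedSpace ℂ 𝔛] in
/-- On the bounded locus (explicit bound) the packing IS the tuple. [folklore] -/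
theorem pack_apply_of_bound {f : I → 𝔛 → ℂ} {x : 𝔛} {M : ℝ} (h : ∀ i, ‖f i x‖ ≤ M) (i : I) :
    pack f x i = f i x :=
  pack_apply (memℓp_infty_of_bound h) i

omit [NormedAddCommGroup 𝔛] [NormedSpace ℂ 𝔛] in
/-- SIZE of the packing: a uniform coordinate bound `M ≥ 0` is a bound of the `ℓ^∞` norm — so the SAME hypothesis that makes
the packing holomorphic on a ball also gives the «maps the ball into `closedBall 0 M`» clause of a `HoloSelfMaps`-type datum.
[folklore] -/
theorem norm_pack_le_of_bound {f : I → 𝔛 → ℂ} {x : 𝔛} {M : ℝ} (hM : 0 ≤ M) (h : ∀ i, ‖f i x‖ ≤ M) : ‖pack f x‖ ≤ M :=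
  lp.norm_le_of_forall_le hM fun i => by rw [pack_apply_of_bound h]; exact h i

omit [NormedAddCommGroup 𝔛] [NormedSpace ℂ 𝔛] in
/-- The packing maps a set on which the family is uniformly bounded by `M ≥ 0` into `closedBall 0 M` of `ℓ^∞`. [folklore] -/
theorem mapsTo_pack_closedBall {f : I → 𝔛 → ℂ} {U : Set 𝔛} {M : ℝ} (hM : 0 ≤ M) (hb : ∀ i, ∀ x ∈ U, ‖f i x‖ ≤ M) :
    MapsTo (pack f) U (closedBall 0 M) := fun x hx => by
  rw [mem_closedBall, dist_zero_right]; exact norm_pack_le_of_bound hM fun i => hb i x hx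

/-- The candidate Fréchet derivative of the packing at `x`: `v ↦ (fderiv ℂ (f i) x v)_i`, a bounded linear map as soon as the
coordinate derivatives are UNIFORMLY bounded in operator norm (by `C ≥ 0`). [folklore] -/
def packDeriv (f : I → 𝔛 → ℂ) (x : 𝔛) (C : ℝ) (hC0 : 0 ≤ C) (hC : ∀ i, ‖fderiv ℂ (f i) x‖ ≤ C) :
    𝔛 →L[ℂ] lp (fun _ : I => ℂ) ∞ :=
  LinearMap.mkContinuous
    { toFun := fun v => ⟨fun i => fderiv ℂ (f i) x v, memℓp_infty_of_bound (M := C * ‖v‖) fun i =>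
        (ContinuousLinearMap.le_opNorm _ _).trans (mul_le_mul_of_nonneg_right (hC i) (norm_nonneg _))⟩
      map_add' := fun v w => by ext i; simp
      map_smul' := fun a v => by ext i; simp }
    C fun v => lp.norm_le_of_forall_le (mul_nonneg hC0 (norm_nonneg _))
      fun i => (ContinuousLinearMap.le_opNorm _ _).trans (mul_le_mul_of_nonneg_right (hC i) (norm_nonneg _))

/-- The candidate derivative acts coordinatewise (definitional). [folklore] -/
@[simp]
theorem packDeriv_apply (f : I → 𝔛 → ℂ) (x : 𝔛) (C : ℝ) (hC0 : 0 ≤ C) (hC : ∀ i, ‖fderiv ℂ (f i) x‖ ≤ C) (v : 𝔛)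
    (i : I) : packDeriv f x C hC0 hC v i = fderiv ℂ (f i) x v :=
  rfl

/-- Operator norm of the candidate derivative `≤ C`. [folklore] -/
theorem norm_packDeriv_le (f : I → 𝔛 → ℂ) (x : 𝔛) (C : ℝ) (hC0 : 0 ≤ C) (hC : ∀ i, ‖fderiv ℂ (f i) x‖ ≤ C) :
    ‖packDeriv f x C hC0 hC‖ ≤ C :=
  LinearMap.mkContinuous_norm_le _ hC0 _

/-- **MAIN LEMMA (ball form).**  If every coordinate `f i` is holomorphic on `ball x R` and the family is UNIFORMLY bounded
there by `M ≥ 0`, the `ℓ^∞`-packing has the Fréchet derivative `v ↦ (fderiv ℂ (f i) x v)_i` at `x` (operator norm `≤ 2M/R`),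
with the UNIFORM remainder `‖pack f w − pack f x − D(w − x)‖_∞ ≤ 4M·(‖w − x‖/R)²` on the ball. [folklore] -/
theorem hasFDerivAt_pack {f : I → 𝔛 → ℂ} {x : 𝔛} {R M : ℝ} (hR : 0 < R) (hM : 0 ≤ M)
    (hd : ∀ i, DifferentiableOn ℂ (f i) (ball x R)) (hb : ∀ i, ∀ w ∈ ball x R, ‖f i w‖ ≤ M) :
    HasFDerivAt (pack f) (packDeriv f x (2 * M / R) (by positivity)
      (fun i => norm_fderiv_le_of_bound hR (hd i) (hb i))) x := by
  set L := packDeriv f x (2 * M / R) (by positivity) (fun i => norm_fderiv_le_of_bound hR (hd i) (hb i)) with hL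
  -- the uniform remainder estimate on the ball
  have hrem : ∀ w ∈ ball x R, ‖pack f w - pack f x - L (w - x)‖ ≤ 4 * M / R ^ 2 * ‖w - x‖ ^ 2 := by
    intro w hw
    have hwb : ∀ i, ‖f i w‖ ≤ M := fun i => hb i w hw
    have hxb : ∀ i, ‖f i x‖ ≤ M := fun i => hb i x (mem_ball_self hR)
    refine lp.norm_le_of_forall_le (by positivity) fun i => ?_
    have hcoord : (pack f w - pack f x - L (w - x)) i = f i w - f i x - fderiv ℂ (f i) x (w - x) := by
      simp only [lp.coeFn_sub, Pi.sub_apply, pack_apply_of_bound hwb, pack_apply_of_bound hxb, hL, packDeriv_apply]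
    rw [hcoord]
    calc ‖f i w - f i x - fderiv ℂ (f i) x (w - x)‖ ≤ 4 * M * (‖w - x‖ / R) ^ 2 :=
          norm_taylor₂_le_of_bound hR (hd i) (hb i) hw
      _ = 4 * M / R ^ 2 * ‖w - x‖ ^ 2 := by
          field_simp
  -- hence the remainder is `O(‖w − x‖²) = o(w − x)`
  refine HasFDerivAt.of_isLittleO ?_
  have hbig : (fun w => pack f w - pack f x - L (w - x)) =O[𝓝 x] fun w => ‖w - x‖ ^ 2 := by
    refine IsBigO.of_bound (4 * M / R ^ 2) ?_
    filter_upwards [ball_mem_nhds x hR] with w hw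
    rw [Real.norm_of_nonneg (by positivity)]
    exact hrem w hw
  exact hbig.trans_isLittleO (isLittleO_pow_sub_sub x one_lt_two)

/-- **MAIN THEOREM (open-set form).**  A family of scalar functions, each holomorphic on an open set `U` of a complex normed
space, UNIFORMLY bounded on `U`, packs into ONE holomorphic `ℓ^∞(I, ℂ)`-valued map on `U`. [folklore] -/
theorem differentiableOn_pack {f : I → 𝔛 → ℂ} {U : Set 𝔛} {M : ℝ} (hU : IsOpen U)
    (hd : ∀ i, DifferentiableOn ℂ (f i) U) (hb : ∀ i, ∀ x ∈ U, ‖f i x‖ ≤ M) :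
    DifferentiableOn ℂ (pack f) U := by
  intro x hx
  obtain ⟨R, hR, hsub⟩ := Metric.isOpen_iff.mp hU x hx
  rcases isEmpty_or_nonempty I with hI | ⟨⟨i⟩⟩
  · -- no coordinates: `ℓ^∞(∅, ℂ)` is a one-point space and the packing is constant
    haveI : Subsingleton (lp (fun _ : I => ℂ) ∞) := ⟨fun a b => lp.ext (funext fun i => (hI.false i).elim)⟩
    exact ((differentiableAt_const (0 : lp (fun _ : I => ℂ) ∞)).congr_of_eventuallyEq
      (Eventually.of_forall fun w => Subsingleton.elim _ _)).differentiableWithinAt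
  · have hM : 0 ≤ M := (norm_nonneg _).trans (hb i x hx)
    exact (hasFDerivAt_pack hR hM (fun i => (hd i).mono hsub) (fun i w hw => hb i w (hsub hw))).differentiableAt
      |>.differentiableWithinAt

/-- The Fréchet derivative of the packing, coordinate by coordinate: `(D(pack f)(x) v)_i = D(f i)(x) v`. [folklore] -/
theorem pack_fderiv_apply {f : I → 𝔛 → ℂ} {U : Set 𝔛} {M : ℝ} (hU : IsOpen U)
    (hd : ∀ i, DifferentiableOn ℂ (f i) U) (hb : ∀ i, ∀ x ∈ U, ‖f i x‖ ≤ M) {x : 𝔛} (hx : x ∈ U) (v : 𝔛) (i : I) :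
    fderiv ℂ (pack f) x v i = fderiv ℂ (f i) x v := by
  obtain ⟨R, hR, hsub⟩ := Metric.isOpen_iff.mp hU x hx
  have hM : 0 ≤ M := (norm_nonneg _).trans (hb i x hx)
  rw [(hasFDerivAt_pack hR hM (fun i => (hd i).mono hsub) (fun i w hw => hb i w (hsub hw))).fderiv, packDeriv_apply]

/-- Operator-norm bound of the derivative of the packing: `‖D(pack f)(x)‖ ≤ 2M/R` whenever `ball x R ⊆ U`. [folklore] -/
theorem norm_fderiv_pack_le {f : I → 𝔛 → ℂ} {x : 𝔛} {R M : ℝ} (hR : 0 < R) (hM : 0 ≤ M)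
    (hd : ∀ i, DifferentiableOn ℂ (f i) (ball x R)) (hb : ∀ i, ∀ w ∈ ball x R, ‖f i w‖ ≤ M) :
    ‖fderiv ℂ (pack f) x‖ ≤ 2 * M / R := by
  rw [(hasFDerivAt_pack hR hM hd hb).fderiv]
  exact norm_packDeriv_le _ _ _ _ _

/-- The UNIFORM second-order remainder of the packing on the ball: `‖pack f w − pack f x − D(pack f)(x)(w − x)‖_∞ ≤
4M·(‖w − x‖/R)²` — the «coordinatewise uniform Cauchy estimate» itself, as a statement. [folklore] -/
theorem norm_pack_taylor₂_le {f : I → 𝔛 → ℂ} {x : 𝔛} {R M : ℝ} (hR : 0 < R) (hM : 0 ≤ M)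
    (hd : ∀ i, DifferentiableOn ℂ (f i) (ball x R)) (hb : ∀ i, ∀ w ∈ ball x R, ‖f i w‖ ≤ M) {w : 𝔛}
    (hw : w ∈ ball x R) :
    ‖pack f w - pack f x - fderiv ℂ (pack f) x (w - x)‖ ≤ 4 * M * (‖w - x‖ / R) ^ 2 := by
  rw [(hasFDerivAt_pack hR hM hd hb).fderiv]
  have hwb : ∀ i, ‖f i w‖ ≤ M := fun i => hb i w hw
  have hxb : ∀ i, ‖f i x‖ ≤ M := fun i => hb i x (mem_ball_self hR)
  refine lp.norm_le_of_forall_le (by positivity) fun i => ?_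
  have hcoord : (pack f w - pack f x - packDeriv f x (2 * M / R) (by positivity)
      (fun i => norm_fderiv_le_of_bound hR (hd i) (hb i)) (w - x)) i = f i w - f i x - fderiv ℂ (f i) x (w - x) := by
    simp only [lp.coeFn_sub, Pi.sub_apply, pack_apply_of_bound hwb, pack_apply_of_bound hxb, packDeriv_apply]
  rw [hcoord]
  exact norm_taylor₂_le_of_bound hR (hd i) (hb i) hw

/-- LOCALLY uniformly bounded version (the natural hypothesis «G-holomorphic coordinates + LOCALLY BOUNDED family»):
differentiability is local, so a uniform bound on some ball inside `U` around each point of `U` suffices (such a `U` is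
automatically open). [folklore] -/
theorem differentiableOn_pack_of_locallyBounded {f : I → 𝔛 → ℂ} {U : Set 𝔛}
    (hd : ∀ i, DifferentiableOn ℂ (f i) U)
    (hb : ∀ x ∈ U, ∃ M R : ℝ, 0 < R ∧ ball x R ⊆ U ∧ ∀ i, ∀ w ∈ ball x R, ‖f i w‖ ≤ M) :
    DifferentiableOn ℂ (pack f) U := by
  intro x hx
  obtain ⟨M, R, hR, hsub, hbM⟩ := hb x hx
  exact ((differentiableOn_pack (U := ball x R) isOpen_ball (fun i => (hd i).mono hsub) hbM).differentiableAt
    (ball_mem_nhds x hR)).differentiableWithinAt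

/-! ## §3 The weighted form (decay-weighted sup norms `sup_i wgt_i·|f i x|`, e.g. `wgt = e^{κ d(X)}`) -/

/-- WEIGHTED ASSEMBLY: if the RESCALED coordinates `wgt i · f i` are uniformly bounded on the open set `U` (this is the
statement «`(f i x)_i` lies in the weighted-sup-norm ball of radius `M`») and each `f i` is holomorphic on `U`, then the weighted
packing `x ↦ (wgt i · f i x)_i ∈ ℓ^∞` is holomorphic on `U`.  (The weighted sup-norm space IS `ℓ^∞` in the rescaled
coordinates; no separate space is introduced.) [folklore] -/
theorem differentiableOn_pack_weighted {f : I → 𝔛 → ℂ} (wgt : I → ℂ) {U : Set 𝔛} {M : ℝ} (hU : IsOpen U)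
    (hd : ∀ i, DifferentiableOn ℂ (f i) U) (hb : ∀ i, ∀ x ∈ U, ‖wgt i * f i x‖ ≤ M) :
    DifferentiableOn ℂ (pack fun i x => wgt i * f i x) U :=
  differentiableOn_pack hU (fun i => (differentiableOn_const (wgt i)).mul (hd i)) hb

/-! ## §4 The same with codomain the bounded functions `I →ᵇ ℂ` (discrete `I`) — for instance typers who model the slice space as
`→ᵇ` rather than `lp … ∞` (Mathlib's linear isometry `lpBCFₗᵢ` transports holomorphy) -/

/-- The packing read in `I →ᵇ ℂ` (discrete topology on the index type). [folklore] -/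
def packBCF [TopologicalSpace I] [DiscreteTopology I] (f : I → 𝔛 → ℂ) (x : 𝔛) : BoundedContinuousFunction I ℂ :=
  lpBCFₗᵢ ℂ ℂ (pack f x)

omit [NormedAddCommGroup 𝔛] [NormedSpace ℂ 𝔛] in
/-- On the bounded locus `packBCF` IS the tuple. [folklore] -/
theorem packBCF_apply [TopologicalSpace I] [DiscreteTopology I] {f : I → 𝔛 → ℂ} {x : 𝔛} {M : ℝ}
    (h : ∀ i, ‖f i x‖ ≤ M) (i : I) : packBCF f x i = f i x := by
  rw [packBCF, coe_lpBCFₗᵢ, pack_apply_of_bound h]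

/-- `→ᵇ`-valued form of the main theorem: uniformly bounded holomorphic scalar coordinates on an open set pack into ONE
holomorphic `(I →ᵇ ℂ)`-valued map. [folklore] -/
theorem differentiableOn_packBCF [TopologicalSpace I] [DiscreteTopology I] {f : I → 𝔛 → ℂ} {U : Set 𝔛} {M : ℝ}
    (hU : IsOpen U) (hd : ∀ i, DifferentiableOn ℂ (f i) U) (hb : ∀ i, ∀ x ∈ U, ‖f i x‖ ≤ M) :
    DifferentiableOn ℂ (packBCF f) U :=
  (lpBCFₗᵢ ℂ ℂ (α := I)).toContinuousLinearEquiv.differentiable.comp_differentiableOn (differentiableOn_pack hU hd hb)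

/-! ## §5 Finite-dimensional domain (e.g. `Pot ≅ ℂⁿ`): the packing is ANALYTIC (tree's Osgood lemma, `F`-valued, `ℓ^∞` complete)
— the `AnalyticOnNhd` vocabulary of the R2′ modules (p249501 `exists_analyticOnNhd_solution`); the ONLY use of the non-Mathlib import
`Literature.Analysis.Complex.OsgoodProofs` in this file (drop §5 and that import for a Mathlib-only module). -/

/-- Finite-dimensional domain: a uniformly bounded holomorphic scalar family packs into an ANALYTIC `ℓ^∞(I, ℂ)`-valued map
(Osgood: holomorphic ⇒ analytic on open sets of finite-dimensional spaces, Banach-valued; `ℓ^∞` is complete). [folklore] -/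
theorem analyticOnNhd_pack [FiniteDimensional ℂ 𝔛] {f : I → 𝔛 → ℂ} {U : Set 𝔛} {M : ℝ} (hU : IsOpen U)
    (hd : ∀ i, DifferentiableOn ℂ (f i) U) (hb : ∀ i, ∀ x ∈ U, ‖f i x‖ ≤ M) :
    AnalyticOnNhd ℂ (pack f) U :=
  Literature.Analysis.Complex.SCV.analyticOnNhd_of_differentiableOn (differentiableOn_pack hU hd hb) hU

/-! ## §T Tests -/

section Tests

/-- T1 NON-VACUITY: the family `z ↦ z ^ n` (`n : ℕ`) on the unit ball of `ℂ` is uniformly bounded by `1`, every coordinate is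
holomorphic, so the packing `z ↦ (z ^ n)_n ∈ ℓ^∞(ℕ, ℂ)` is holomorphic on the unit ball — the theorem FIRES. -/
example : DifferentiableOn ℂ (pack fun (n : ℕ) (z : ℂ) => z ^ n) (ball (0 : ℂ) 1) :=
  differentiableOn_pack (M := 1) isOpen_ball (fun n => (differentiable_pow n).differentiableOn) fun n z hz => by
    rw [norm_pow]
    exact pow_le_one₀ (norm_nonneg _) (le_of_lt (by simpa using hz))

/-- T2 NECESSITY OF THE UNIFORM BOUND: for the family `z ↦ n·z` every coordinate is entire and bounded on the unit ball
(by `n`), but NOT uniformly; at any `z ≠ 0` the tuple `(n·z)_n` is not in `ℓ^∞`, so no `ℓ^∞`-valued map extends the family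
there (the packing returns its junk value `0`). -/
example {z : ℂ} (hz : z ≠ 0) : ¬ Memℓp (fun n : ℕ => (n : ℂ) * z) ∞ := by
  intro h
  obtain ⟨C, hC⟩ := memℓp_infty_iff.mp h
  have hzpos : 0 < ‖z‖ := norm_pos_iff.mpr hz
  obtain ⟨n, hn⟩ := exists_nat_gt (C / ‖z‖)
  have h1 : ‖(n : ℂ) * z‖ ≤ C := hC ⟨n, rfl⟩
  rw [norm_mul, Complex.norm_natCast] at h1
  have h2 : (n : ℝ) * ‖z‖ > C := by
    have := (div_lt_iff₀ hzpos).mp hn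
    linarith
  linarith

end Tests

end Summit.QuantumFields.BalabanUV.T4Continuum.NE9EllInftyHolomorphy

end
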